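import Literature.NumberTheory.Automorphic.UnitaryLatticeTreeGeodesicApartment       -- ★ Enum apartment `A`: `dist_latticeGraphIso_apartmentEnum`, `exists_latticeGraphIso_apartmentEnum_of_isSelfDualLattice`, `coe_apartmentEnum_zero`, `exists_apartmentEnum`
import Literature.NumberTheory.Automorphic.UnitaryLatticeTreeStabilizer               -- ★ `mapGL_stdLattice_eq_iff` (stabiliser of the root `𝒪³` in `GL₃`)
import Literature.NumberTheory.Automorphic.UnitaryLatticeTreeStarOfInvolution         -- ★ `isSelfDualLattice_stdLattice_three_of_v`, `exists_latticeGraphIso_root_eq_of_trace` (`U` transitive on hyperspecial vertices)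
import Literature.NumberTheory.Automorphic.UnitaryLatticeTreeValencyInertPlace        -- ★ `ncard_sphere_of_isSelfDualLattice_inert` (all sphere sizes about a hyperspecial vertex at an inert place)
import Literature.NumberTheory.Automorphic.HyperspecialUnitaryRankOneHeckeNeighbours  -- ★ `UnramifiedLocalConjDatum.torusGen` (`t = diag(ϖ, 1, ϖ⁻¹)`), `coe_torusGen_pow`
import HarnessLib

/-!
# R90 · S6 «Ch. 14.1–14.5 stable TF» — WAVE 7 card W7-i: THE CARTAN SHELL `K₀ tᵐ K₀ ∕ K₀` IS THE SPHERE OF RADIUS `2m` ABOUT THE ROOT OF THE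
# `U(3)` LATTICE TREE, hence `#(K₀ tᵐ K₀ ∕ K₀) = (q_v³ + 1) · q_v^m · q_v^{3(m−1)}` at an inert place (`Theorems/R90S6CartanShellSphere.lean`)

Cell `hodgecm-mathlib`, crux H413 (`stmt-HodgeConjecture-24833`), route `HCCMUnconditional`; programme R90-TF, section S6 (base `R90-C14`, dealer
R90-C14-plan (g2)), seat R90-C14-p07 (g0); card W7-i of the S6 WAVE 7 menu (`R90/R90-szE1.1/g3/CLOSURE-E1.1.md` §3, DAG row E1.3.5.1.3 «SPHERES =
CARTAN DOUBLE COSETS», instantiation half; payer of the index input of E1.3.9.1 ∕ W7-a «eG-independence»: `m ↦ #(K₀ tᵐ K₀ ∕ K₀)` in closed form).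
Lane `--kind proof --supports stmt-HodgeConjecture-24833 --as helper`; THEOREMS ONLY (no definition, no instance, no notation, no named fact, no `sorry`);
imports ★ Literature (`UnitaryLatticeTree*`, `HyperspecialUnitaryRankOneHeckeNeighbours`) + HarnessLib.

THE MATHEMATICS [BruhatTits1972, §10, (4.4.4); Serre, *Trees* II.1.1; Tits1979, §2.4, §3.3.3].  `K` a discretely valued field with the cell's unramified datum
`hd : UnramifiedLocalConjDatum σ ϖ` (involution `σ` preserving `v`, `σ`-fixed uniformiser `ϖ`), `U = U(σ, J₀)(K)` the quasi-split unitary group in three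
variables, `K₀ = unitaryInt σ J₀ = U ∩ GL₃(𝒪)` its hyperspecial subgroup, `t = hd.torusGen = diag(ϖ, 1, ϖ⁻¹) ∈ U`, and `X` the ★ lattice tree of `(K³, J₀)`
(`latticeGraph σ ϖ J₀`, a `(q³+1, q+1)`-biregular TREE ★ `isTree_latticeGraph_three_of_unramified`) with its ★ enumerated standard apartment `A : ℤ → X`,
`A(2a) = diag(ϖ^a, 1, ϖ^{−a})·𝒪³`, root `A 0 = 𝒪³`.  Then:
(§1) the stabiliser of the root in `U` is `K₀` (`latticeGraphIso_apartmentEnum_zero_eq_iff`), so `u ↦ u · A 0` identifies `U ∕ K₀` with the `U`-orbit of the root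
(= all hyperspecial vertices, ★ `exists_latticeGraphIso_root_eq_of_trace` — the orbit–stabiliser dictionary `latticeGraphIso_apartmentEnum_zero_eq_latticeGraphIso_iff`,
`exists_latticeGraphIso_apartmentEnum_zero_eq_iff`);
(§2) `tᵐ · A 0 = A(2m)` and `K₀` moves `A j` only along the sphere of radius `|j|` about the root (`dist_apartmentEnum_zero_latticeGraphIso_of_mem_unitaryInt`);
(§3) **the dictionary carries the `K₀`-orbit of the coset `tᵐ K₀` — i.e. `K₀ tᵐ K₀ ∕ K₀` — BIJECTIVELY onto the sphere `S_{2m}(A 0)`**: into the sphere by §2, onto it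
because any vertex `y` lies together with the root in ONE apartment translate `A 0 = u·A 0`, `y = u·A j` (★ `exists_latticeGraphIso_apartmentEnum_of_isSelfDualLattice`),
whence `u ∈ K₀`, `j = dist = 2m` and `y = (u tᵐ)·A 0`; so **`#(K₀ tᵐ K₀ ∕ K₀) = #S_{2m}(A 0)`** (`ncard_orbit_torusGen_pow_eq_ncard_sphere`, as `Set.ncard` of
`MulAction.orbit K₀ (tᵐ : U ⧸ K₀)` — the currency of ★ `heckeOperator` ∕ `finite_orbit_quotient` and of the W7-a sheet);
(§4) at an INERT place `w ∣ v` of a quadratic extension of number fields (`σ = σ_w`, `K = E_w`) ★ `ncard_sphere_of_isSelfDualLattice_inert` evaluates the sphere: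
**`#(K₀ tᵐ K₀ ∕ K₀) = (q_v³ + 1) · q_v^m · (q_v³)^{m−1}`** for `m ≥ 1` (`ncard_orbit_torusGen_pow_inert`; `m = 1`: `q_v⁴ + q_v`, [Rogawski1990, §4.9 ∕ BR₁ counting road];
`m = 0`: `1`), and these indices are pairwise distinct in `m` (`ncard_orbit_torusGen_pow_injective_inert`) — the `hsep` input of W7-a.3.
HONEST LABEL: lattice-model bookkeeping over ★ carriers; proves no printed global statement, discharges no citation; count-neutral until E1.3.9 consumes it.
HC_CM is proved only modulo the 7 printed citations (2 remaining named inputs: hLiu418 = stmt-HodgeConjecture-24832, h413 = stmt-HodgeConjecture-24833) until rung 0 closes.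

## References
* [BruhatTits1972] F. Bruhat, J. Tits, *Groupes réductifs sur un corps local I*, Publ. Math. IHÉS 41 (1972), §10, (4.4.4).
* [Serre1980Trees] J.-P. Serre, *Trees* (1980), Ch. II §1.1.
* [Tits1979] J. Tits, *Reductive groups over local fields*, PSPM 33.1 (1979), §2.4, §3.3.3.
* [Rogawski1990] J. D. Rogawski, *Automorphic Representations of Unitary Groups in Three Variables*, Ann. of Math. Stud. 123 (1990), §4.9 pp. 55–56.
-/
set_option autoImplicit false
-- the mandated namespace repeats the single-problem summit's segment (`HodgeConjecture.HodgeConjecture`)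
set_option linter.dupNamespace false

noncomputable section

open scoped Valued WithZero Matrix MatrixGroups
open MulAction
open Literature.NumberTheory.Automorphic Literature.NumberTheory.Automorphic.HermitianLattice
open Literature.NumberTheory.Automorphic.UnitaryLatticeTree
open Literature.NumberTheory.Automorphic.CartanUnique (uniformizer_ne_zero)

namespace Summit.HodgeConjecture.HodgeConjecture.R90.S6

variable {K : Type*} [Field K] [Valued K ℤᵐ⁰] {σ : K →+* K} {ϖ : K}

section Enum

variable (hd : UnramifiedLocalConjDatum σ ϖ)
  (A : ℤ → {M : Submodule 𝒪[K] (Fin 3 → K) // IsVertex σ ϖ ((StdForm.antidiagonal 3).over K) M})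
  (hA0 : ∀ a : ℤ, (A (2 * a)).1 = latt (Matrix.diagonal ![ϖ ^ a, (1 : K), ϖ ^ (-a)]))
  (hA1 : ∀ a : ℤ, (A (2 * a + 1)).1 = latt (Matrix.diagonal ![ϖ ^ (a + 1), (1 : K), ϖ ^ (-a)]))
include hd hA0 hA1

/-! ### §1 The stabiliser of the root `A 0 = 𝒪³` in `U(σ, J₀)` is `K₀ = U ∩ GL₃(𝒪)`; cosets of `K₀` ↔ translates of the root -/

omit hd hA1 in
/-- **`Stab_U(A 0) = K₀`**: `u · A 0 = A 0 ↔ u ∈ K₀ = unitaryInt σ J₀` (the root is `𝒪³`, whose stabiliser in `GL₃(K)` is `GL₃(𝒪)`, ★ `mapGL_stdLattice_eq_iff`).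
[cite: Serre1980Trees, II.1.1] [cite: Tits1979, §3.3.3] -/
theorem latticeGraphIso_apartmentEnum_zero_eq_iff (u : ↥(unitaryGroupOfForm σ ((StdForm.antidiagonal 3).over K))) :
    latticeGraphIso σ ϖ ((StdForm.antidiagonal 3).over K) u (A 0) = A 0 ↔ u ∈ unitaryInt σ ((StdForm.antidiagonal 3).over K) := by
  rw [← Subtype.coe_inj, latticeGraphIso_apply_val, coe_apartmentEnum_zero A hA0, mapGL_stdLattice_eq_iff, mem_unitaryInt_iff]
  rfl

omit hd hA1 in
/-- **Orbit–stabiliser, coset form**: `u · A 0 = u′ · A 0 ↔ u K₀ = u′ K₀` — the map `u K₀ ↦ u · A 0` is well defined on `U ∕ K₀` and injective.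
[cite: Serre1980Trees, II.1.1] [cite: BruhatTits1972, §10] -/
theorem latticeGraphIso_apartmentEnum_zero_eq_latticeGraphIso_iff (u u' : ↥(unitaryGroupOfForm σ ((StdForm.antidiagonal 3).over K))) :
    latticeGraphIso σ ϖ ((StdForm.antidiagonal 3).over K) u (A 0) = latticeGraphIso σ ϖ ((StdForm.antidiagonal 3).over K) u' (A 0) ↔
      (u : ↥(unitaryGroupOfForm σ ((StdForm.antidiagonal 3).over K)) ⧸ unitaryInt σ ((StdForm.antidiagonal 3).over K)) = u' := by
  rw [QuotientGroup.eq, ← latticeGraphIso_apartmentEnum_zero_eq_iff A hA0 (u⁻¹ * u'), ← Subtype.coe_inj, ← Subtype.coe_inj,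
    latticeGraphIso_apply_val, latticeGraphIso_apply_val, latticeGraphIso_apply_val, Subgroup.coe_mul, Subgroup.coe_inv, mapGL_mul]
  constructor
  · intro h
    rw [← h, ← mapGL_mul, inv_mul_cancel, mapGL_one]
  · intro h
    conv_lhs => rw [← h, ← mapGL_mul, mul_inv_cancel, mapGL_one]

omit hd hA1 in
/-- The chosen representative of the coset `u K₀` translates the root to the same vertex as `u`. [cite: Serre1980Trees, II.1.1] -/
theorem latticeGraphIso_out_coe_apartmentEnum_zero (u : ↥(unitaryGroupOfForm σ ((StdForm.antidiagonal 3).over K))) :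
    latticeGraphIso σ ϖ ((StdForm.antidiagonal 3).over K)
        ((u : ↥(unitaryGroupOfForm σ ((StdForm.antidiagonal 3).over K)) ⧸ unitaryInt σ ((StdForm.antidiagonal 3).over K)).out) (A 0) =
      latticeGraphIso σ ϖ ((StdForm.antidiagonal 3).over K) u (A 0) :=
  (latticeGraphIso_apartmentEnum_zero_eq_latticeGraphIso_iff A hA0 _ _).2 (QuotientGroup.out_eq' _)

omit hA1 in
/-- **The `U`-orbit of the root is the set of hyperspecial (self-dual) vertices**: every self-dual vertex is `u · A 0` (★ `exists_latticeGraphIso_root_eq_of_trace` with the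
datum's trace element), and conversely (types are `U`-invariant). [cite: BruhatTits1972, §10] [cite: Tits1979, §3.3.3] -/
theorem exists_latticeGraphIso_apartmentEnum_zero_eq_iff
    (y : {M : Submodule 𝒪[K] (Fin 3 → K) // IsVertex σ ϖ ((StdForm.antidiagonal 3).over K) M}) :
    (∃ u : ↥(unitaryGroupOfForm σ ((StdForm.antidiagonal 3).over K)), latticeGraphIso σ ϖ ((StdForm.antidiagonal 3).over K) u (A 0) = y) ↔
      IsSelfDualLattice σ ϖ ((StdForm.antidiagonal 3).over K) y.1 := by
  have hA : IsSelfDualLattice σ ϖ ((StdForm.antidiagonal 3).over K) (A 0).1 := by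
    rw [coe_apartmentEnum_zero A hA0]; exact isSelfDualLattice_stdLattice_three_of_v hd.vϖ
  constructor
  · rintro ⟨u, rfl⟩
    rw [latticeGraphIso_apply_val]
    exact (isVertexLattice_mapGL_iff σ ϖ ((StdForm.antidiagonal 3).over K) u (A 0).1).2 hA
  · intro hy
    obtain ⟨u₀, hu₀⟩ := exists_latticeGraphIso_root_eq_of_trace hd.σσ hd.vσ hd.vϖ hd.trace (A 0) hA
    obtain ⟨u, hu⟩ := exists_latticeGraphIso_root_eq_of_trace hd.σσ hd.vσ hd.vϖ hd.trace y hy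
    refine ⟨u * u₀⁻¹, ?_⟩
    rw [← hu, ← hu₀]
    apply Subtype.ext
    rw [latticeGraphIso_apply_val, latticeGraphIso_apply_val, latticeGraphIso_apply_val, Subgroup.coe_mul, Subgroup.coe_inv, mapGL_mul,
      ← mapGL_mul ((u₀ : GL (Fin 3) K)⁻¹), inv_mul_cancel, mapGL_one]

/-! ### §2 The torus power `tᵐ` moves the root to `A(2m)`; `K₀` preserves the spheres about the root -/

omit hA1 in
/-- **`tᵐ · A 0 = A(2m)`** for `t = hd.torusGen = diag(ϖ, 1, ϖ⁻¹)`: `tᵐ · 𝒪³ = diag(ϖ^m, 1, ϖ^{−m}) · 𝒪³ = L_m`. [cite: BruhatTits1972, (4.4.3), §10] [cite: Serre1980Trees, II.1.1] -/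
theorem latticeGraphIso_torusGen_pow_apartmentEnum_zero (m : ℕ) :
    latticeGraphIso σ ϖ ((StdForm.antidiagonal 3).over K) (hd.torusGen ^ m) (A 0) = A (2 * (m : ℤ)) := by
  apply Subtype.ext
  rw [latticeGraphIso_apply_val, coe_apartmentEnum_zero A hA0, hA0 (m : ℤ), hd.coe_torusGen_pow m]
  change latt (((zpowDiagGL (uniformizer_ne_zero hd.vϖ) ((m : ℤ) • (![1, 0, -1] : Fin 3 → ℤ)) : GL (Fin 3) K) : Matrix (Fin 3) (Fin 3) K)) = _
  rw [coe_zpowDiagGL]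
  congr 1
  funext i j
  rw [Matrix.diagonal_apply, Matrix.diagonal_apply]
  split_ifs with h
  · subst h
    fin_cases i <;> simp
  · rfl

/-- **`K₀` preserves the spheres about the root**: for `k ∈ K₀`, `dist(A 0, k · A j) = |j|` (`k` fixes `A 0` and is an isometry of the tree; ★ `dist_latticeGraphIso_apartmentEnum`).
[cite: Serre1980Trees, II.1.1] [cite: BruhatTits1972, §10] -/
theorem dist_apartmentEnum_zero_latticeGraphIso_of_mem_unitaryInt {k : ↥(unitaryGroupOfForm σ ((StdForm.antidiagonal 3).over K))}
    (hk : k ∈ unitaryInt σ ((StdForm.antidiagonal 3).over K)) (j : ℤ) :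
    (latticeGraph σ ϖ ((StdForm.antidiagonal 3).over K)).dist (A 0) (latticeGraphIso σ ϖ ((StdForm.antidiagonal 3).over K) k (A j)) = j.natAbs := by
  conv_lhs => rw [← (latticeGraphIso_apartmentEnum_zero_eq_iff A hA0 k).2 hk]
  rw [dist_latticeGraphIso_apartmentEnum hd A hA0 hA1 k 0 j, sub_zero]

/-- **The shell lies on the sphere**: for `k ∈ K₀`, `(k tᵐ) · A 0 = k · A(2m)` is at distance `2m` from the root. [cite: BruhatTits1972, (4.4.4)] [cite: Serre1980Trees, II.1.1] -/
theorem dist_apartmentEnum_zero_latticeGraphIso_mul_torusGen_pow {k : ↥(unitaryGroupOfForm σ ((StdForm.antidiagonal 3).over K))}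
    (hk : k ∈ unitaryInt σ ((StdForm.antidiagonal 3).over K)) (m : ℕ) :
    (latticeGraph σ ϖ ((StdForm.antidiagonal 3).over K)).dist (A 0) (latticeGraphIso σ ϖ ((StdForm.antidiagonal 3).over K) (k * hd.torusGen ^ m) (A 0)) = 2 * m := by
  have hmul : latticeGraphIso σ ϖ ((StdForm.antidiagonal 3).over K) (k * hd.torusGen ^ m) (A 0) =
      latticeGraphIso σ ϖ ((StdForm.antidiagonal 3).over K) k (A (2 * (m : ℤ))) := by
    rw [← latticeGraphIso_torusGen_pow_apartmentEnum_zero hd A hA0 m]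
    apply Subtype.ext
    rw [latticeGraphIso_apply_val, latticeGraphIso_apply_val, latticeGraphIso_apply_val, Subgroup.coe_mul, mapGL_mul]
  rw [hmul, dist_apartmentEnum_zero_latticeGraphIso_of_mem_unitaryInt hd A hA0 hA1 hk]
  omega

/-! ### §3 The Cartan shell `K₀ tᵐ K₀ ∕ K₀` ↔ the sphere of radius `2m` about the root -/

/-- **THE CARTAN SHELL IS THE SPHERE: `#(K₀ tᵐ K₀ ∕ K₀) = #S_{2m}(A 0)`.**  The dictionary `u K₀ ↦ u · A 0` restricts to a bijection from the `K₀`-orbit of the coset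
`tᵐ K₀` in `U ∕ K₀` (the left cosets inside the double coset `K₀ tᵐ K₀`) onto the vertices at distance `2m` from the root: INTO by §2, INJECTIVE by §1, ONTO because the
root and any vertex `y` lie in a common apartment translate `A 0 = u · A 0`, `y = u · A j`, `0 ≤ j` (★ `exists_latticeGraphIso_apartmentEnum_of_isSelfDualLattice`), forcing
`u ∈ K₀`, `j = dist(A 0, y) = 2m` and `y = (u tᵐ) · A 0`.  Stated with `Set.ncard` (both sides are finite at a place with finite residue field; no finiteness is
assumed here — `Set.ncard_congr` transports the junk value `0` as well). [cite: BruhatTits1972, §10, (4.4.4)] [cite: Serre1980Trees, II.1.1] -/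
theorem ncard_orbit_torusGen_pow_eq_ncard_sphere (m : ℕ) :
    (MulAction.orbit (unitaryInt σ ((StdForm.antidiagonal 3).over K))
        ((hd.torusGen ^ m : ↥(unitaryGroupOfForm σ ((StdForm.antidiagonal 3).over K))) :
          ↥(unitaryGroupOfForm σ ((StdForm.antidiagonal 3).over K)) ⧸ unitaryInt σ ((StdForm.antidiagonal 3).over K))).ncard =
      {y | (latticeGraph σ ϖ ((StdForm.antidiagonal 3).over K)).dist (A 0) y = 2 * m}.ncard := by
  refine Set.ncard_congr (fun q _ => latticeGraphIso σ ϖ ((StdForm.antidiagonal 3).over K) q.out (A 0)) (fun q hq => ?_)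
    (fun q q' _ _ h => ?_) (fun y hy => ?_)
  · -- INTO: `q = k • tᵐ K₀ = (k tᵐ) K₀` with `k ∈ K₀`
    obtain ⟨k, rfl⟩ := MulAction.mem_orbit_iff.1 hq
    -- `k • (tᵐ K₀) = (k tᵐ) K₀` definitionally (the `K₀`-action on `U ⧸ K₀` is left multiplication)
    have hk : (k • ((hd.torusGen ^ m : ↥(unitaryGroupOfForm σ ((StdForm.antidiagonal 3).over K))) :
          ↥(unitaryGroupOfForm σ ((StdForm.antidiagonal 3).over K)) ⧸ unitaryInt σ ((StdForm.antidiagonal 3).over K))) =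
        (((k : ↥(unitaryGroupOfForm σ ((StdForm.antidiagonal 3).over K))) * hd.torusGen ^ m :
            ↥(unitaryGroupOfForm σ ((StdForm.antidiagonal 3).over K))) :
          ↥(unitaryGroupOfForm σ ((StdForm.antidiagonal 3).over K)) ⧸ unitaryInt σ ((StdForm.antidiagonal 3).over K)) := rfl
    rw [Set.mem_setOf_eq, hk, latticeGraphIso_out_coe_apartmentEnum_zero A hA0]
    exact dist_apartmentEnum_zero_latticeGraphIso_mul_torusGen_pow hd A hA0 hA1 k.2 m
  · -- INJECTIVE: equal root translates ⇒ equal cosets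
    have h' := (latticeGraphIso_apartmentEnum_zero_eq_latticeGraphIso_iff A hA0 q.out q'.out).1 h
    rwa [QuotientGroup.out_eq', QuotientGroup.out_eq'] at h'
  · -- ONTO: place the root and `y` in one apartment translate
    have hA : IsSelfDualLattice σ ϖ ((StdForm.antidiagonal 3).over K) (A 0).1 := by
      rw [coe_apartmentEnum_zero A hA0]; exact isSelfDualLattice_stdLattice_three_of_v hd.vϖ
    obtain ⟨u, j, hj, hx, hyu⟩ := exists_latticeGraphIso_apartmentEnum_of_isSelfDualLattice hd A hA0 hA1 hA y
    have hu : u ∈ unitaryInt σ ((StdForm.antidiagonal 3).over K) := (latticeGraphIso_apartmentEnum_zero_eq_iff A hA0 u).1 hx.symm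
    have hj2 : j = 2 * (m : ℤ) := by
      rw [Set.mem_setOf_eq, hyu, dist_apartmentEnum_zero_latticeGraphIso_of_mem_unitaryInt hd A hA0 hA1 hu] at hy
      omega
    refine ⟨((u * hd.torusGen ^ m : ↥(unitaryGroupOfForm σ ((StdForm.antidiagonal 3).over K))) :
        ↥(unitaryGroupOfForm σ ((StdForm.antidiagonal 3).over K)) ⧸ unitaryInt σ ((StdForm.antidiagonal 3).over K)),
      MulAction.mem_orbit_iff.2 ⟨⟨u, hu⟩, rfl⟩, ?_⟩
    · rw [latticeGraphIso_out_coe_apartmentEnum_zero A hA0, hyu, hj2, ← latticeGraphIso_torusGen_pow_apartmentEnum_zero hd A hA0 m]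
      apply Subtype.ext
      rw [latticeGraphIso_apply_val, latticeGraphIso_apply_val, latticeGraphIso_apply_val, Subgroup.coe_mul, mapGL_mul]

end Enum

/-! ### §3′ Apartment-free restatements (root `𝒪³` written out; the apartment is supplied by ★ `exists_apartmentEnum`) -/

section Root

variable (hd : UnramifiedLocalConjDatum σ ϖ)

/-- **`#(K₀ tᵐ K₀ ∕ K₀) = #S_{2m}(𝒪³)`**, apartment-free form of `ncard_orbit_torusGen_pow_eq_ncard_sphere` (root vertex `⟨𝒪³, self-dual⟩` written out;
★ `isSelfDualLattice_stdLattice_three_of_v`). [cite: BruhatTits1972, §10, (4.4.4)] [cite: Serre1980Trees, II.1.1] -/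
theorem ncard_orbit_torusGen_pow_eq_ncard_sphere_stdLattice (m : ℕ) :
    (MulAction.orbit (unitaryInt σ ((StdForm.antidiagonal 3).over K))
        ((hd.torusGen ^ m : ↥(unitaryGroupOfForm σ ((StdForm.antidiagonal 3).over K))) :
          ↥(unitaryGroupOfForm σ ((StdForm.antidiagonal 3).over K)) ⧸ unitaryInt σ ((StdForm.antidiagonal 3).over K))).ncard =
      {y | (latticeGraph σ ϖ ((StdForm.antidiagonal 3).over K)).dist ⟨stdLattice K 3, 0, isSelfDualLattice_stdLattice_three_of_v hd.vϖ⟩ y = 2 * m}.ncard := by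
  obtain ⟨A, hA0, hA1⟩ := exists_apartmentEnum hd
  have h0 : A 0 = ⟨stdLattice K 3, 0, isSelfDualLattice_stdLattice_three_of_v hd.vϖ⟩ := Subtype.ext (coe_apartmentEnum_zero A hA0)
  rw [← h0]
  exact ncard_orbit_torusGen_pow_eq_ncard_sphere hd A hA0 hA1 m

variable (σ) in
omit hd in
/-- The trivial shell: `#(K₀ 1 K₀ ∕ K₀) = 1` — the `K₀`-orbit of the identity coset is `{K₀}` (pure group theory; sanity companion of the `m ≥ 1` closed form
below, used for the injectivity in `m`). [cite: Serre1980Trees, II.1.1] -/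
theorem ncard_orbit_one_eq_one :
    (MulAction.orbit (unitaryInt σ ((StdForm.antidiagonal 3).over K))
        ((1 : ↥(unitaryGroupOfForm σ ((StdForm.antidiagonal 3).over K))) :
          ↥(unitaryGroupOfForm σ ((StdForm.antidiagonal 3).over K)) ⧸ unitaryInt σ ((StdForm.antidiagonal 3).over K))).ncard = 1 := by
  rw [Set.ncard_eq_one]
  refine ⟨((1 : ↥(unitaryGroupOfForm σ ((StdForm.antidiagonal 3).over K))) :
      ↥(unitaryGroupOfForm σ ((StdForm.antidiagonal 3).over K)) ⧸ unitaryInt σ ((StdForm.antidiagonal 3).over K)),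
    Set.eq_singleton_iff_unique_mem.2 ⟨MulAction.mem_orbit_self _, fun q hq => ?_⟩⟩
  obtain ⟨k, rfl⟩ := MulAction.mem_orbit_iff.1 hq
  change (((k : ↥(unitaryGroupOfForm σ ((StdForm.antidiagonal 3).over K))) * 1 : ↥(unitaryGroupOfForm σ ((StdForm.antidiagonal 3).over K))) :
      ↥(unitaryGroupOfForm σ ((StdForm.antidiagonal 3).over K)) ⧸ unitaryInt σ ((StdForm.antidiagonal 3).over K)) = _
  rw [QuotientGroup.eq, mul_one, mul_one]
  exact Subgroup.inv_mem _ k.2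

end Root

/-! ### §4 At an inert place: `#(K₀ tᵐ K₀ ∕ K₀) = (q_v³ + 1) · q_v^m · (q_v³)^{m−1}`, pairwise distinct in `m` -/

section InertPlace

open _root_.NumberField _root_.IsDedekindDomain Literature.NumberTheory.Automorphic.UnitaryGroup

variable {F E : Type} [Field F] [NumberField F] [Field E] [NumberField E] [Algebra F E] [Algebra.IsQuadraticExtension F E]
  (c : E ≃ₐ[F] E) (v : HeightOneSpectrum (𝓞 F))

/-- **THE INDEX OF THE CARTAN SHELL at an inert place `w ∣ v` of a quadratic extension `E ∕ F` of number fields** (`v` unramified in `E`, `c • w = w`, `σ = σ_w`,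
`K = E_w`, any unramified datum `hd`, `t = hd.torusGen`, `q_v = |𝓞_F ∕ v|`): for `m ≥ 1`,
`#(K₀ tᵐ K₀ ∕ K₀) = #S_{2m}(𝒪³) = (q_v³ + 1) · q_v^m · (q_v³)^{m−1}` (`= q_v⁴ + q_v` at `m = 1`: the `q⁴ + q` hyperspecial Hecke neighbours ★ `bijOn_heckeNeighbours`).
(§3 + ★ `ncard_sphere_of_isSelfDualLattice_inert` at radius `2m` about the root, `(2m)∕2 = m`, `(2m−1)∕2 = m−1`.) [cite: BruhatTits1972, (4.4.4)] [cite: Tits1979, §2.4] -/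
theorem ncard_orbit_torusGen_pow_inert (hc : c ≠ 1) (hv : Algebra.IsUnramifiedIn (𝓞 E) v.asIdeal) (w : UnitaryGroup.PlacesOver E v) (hw : c • w.1 = w.1)
    {ϖ : w.1.adicCompletion E} (hd : UnramifiedLocalConjDatum (galAdicCompletionMap (L := E) c hw) ϖ) {m : ℕ} (hm : 1 ≤ m) :
    (MulAction.orbit (unitaryInt (galAdicCompletionMap (L := E) c hw) ((StdForm.antidiagonal 3).over (w.1.adicCompletion E)))
        ((hd.torusGen ^ m : ↥(unitaryGroupOfForm (galAdicCompletionMap (L := E) c hw) ((StdForm.antidiagonal 3).over (w.1.adicCompletion E)))) :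
          ↥(unitaryGroupOfForm (galAdicCompletionMap (L := E) c hw) ((StdForm.antidiagonal 3).over (w.1.adicCompletion E))) ⧸
            unitaryInt (galAdicCompletionMap (L := E) c hw) ((StdForm.antidiagonal 3).over (w.1.adicCompletion E)))).ncard =
      (Nat.card (𝓞 F ⧸ v.asIdeal) ^ 3 + 1) * Nat.card (𝓞 F ⧸ v.asIdeal) ^ m * (Nat.card (𝓞 F ⧸ v.asIdeal) ^ 3) ^ (m - 1) := by
  obtain ⟨A, hA0, hA1⟩ := exists_apartmentEnum hd
  have hA : IsSelfDualLattice (galAdicCompletionMap (L := E) c hw) ϖ ((StdForm.antidiagonal 3).over (w.1.adicCompletion E)) (A 0).1 := by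
    rw [coe_apartmentEnum_zero A hA0]; exact isSelfDualLattice_stdLattice_three_of_v hd.vϖ
  rw [ncard_orbit_torusGen_pow_eq_ncard_sphere hd A hA0 hA1 m,
    ncard_sphere_of_isSelfDualLattice_inert c v hc hv w hw hd (A 0) hA (show 1 ≤ 2 * m by omega),
    Nat.mul_div_cancel_left m (by norm_num : 0 < 2), show (2 * m - 1) / 2 = m - 1 by omega]

/-- **The shell indices separate the shells**: at an inert place the function `m ↦ #(K₀ tᵐ K₀ ∕ K₀)` is INJECTIVE on `ℕ` (`1` at `m = 0`, and
`(q_v³+1) · q_v^{4m−3}`, strictly increasing, for `m ≥ 1`; `q_v ≥ 2`) — the `hsep` input of the eG-independence lemma W7-a.3 on the Cartan shells.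
[cite: BruhatTits1972, (4.4.4)] [cite: Tits1979, §2.4] -/
theorem ncard_orbit_torusGen_pow_injective_inert (hc : c ≠ 1) (hv : Algebra.IsUnramifiedIn (𝓞 E) v.asIdeal) (w : UnitaryGroup.PlacesOver E v)
    (hw : c • w.1 = w.1) {ϖ : w.1.adicCompletion E} (hd : UnramifiedLocalConjDatum (galAdicCompletionMap (L := E) c hw) ϖ) :
    Function.Injective fun m : ℕ =>
      (MulAction.orbit (unitaryInt (galAdicCompletionMap (L := E) c hw) ((StdForm.antidiagonal 3).over (w.1.adicCompletion E)))
        ((hd.torusGen ^ m : ↥(unitaryGroupOfForm (galAdicCompletionMap (L := E) c hw) ((StdForm.antidiagonal 3).over (w.1.adicCompletion E)))) :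
          ↥(unitaryGroupOfForm (galAdicCompletionMap (L := E) c hw) ((StdForm.antidiagonal 3).over (w.1.adicCompletion E))) ⧸
            unitaryInt (galAdicCompletionMap (L := E) c hw) ((StdForm.antidiagonal 3).over (w.1.adicCompletion E)))).ncard := by
  -- `q_v ≥ 2`
  have hq1 : 1 < Nat.card (𝓞 F ⧸ v.asIdeal) := by
    have h := NumberField.HeightOneSpectrum.one_lt_absNorm v
    rwa [Ideal.absNorm_apply, Submodule.cardQuot_apply] at h
  have hq3 : 0 < Nat.card (𝓞 F ⧸ v.asIdeal) ^ 3 := pow_pos (lt_trans Nat.zero_lt_one hq1) 3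
  -- the index is strictly increasing in `m`: `1 < (q³+1)·q` and `(q³+1) q^n (q³)^(n−1) < (q³+1) q^(n+1) (q³)^n`
  refine StrictMono.injective (strictMono_nat_of_lt_succ fun n => ?_)
  rcases Nat.eq_zero_or_pos n with rfl | hn
  · rw [pow_zero, ncard_orbit_one_eq_one, zero_add, ncard_orbit_torusGen_pow_inert c v hc hv w hw hd le_rfl, pow_one,
      Nat.sub_self, pow_zero, mul_one]
    calc 1 < Nat.card (𝓞 F ⧸ v.asIdeal) := hq1
      _ = 1 * Nat.card (𝓞 F ⧸ v.asIdeal) := (one_mul _).symm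
      _ ≤ (Nat.card (𝓞 F ⧸ v.asIdeal) ^ 3 + 1) * Nat.card (𝓞 F ⧸ v.asIdeal) := Nat.mul_le_mul_right _ (Nat.le_add_left 1 _)
  · rw [ncard_orbit_torusGen_pow_inert c v hc hv w hw hd hn, ncard_orbit_torusGen_pow_inert c v hc hv w hw hd (Nat.le_add_left 1 n),
      Nat.add_sub_cancel]
    exact mul_lt_mul (mul_lt_mul_of_pos_left (pow_lt_pow_right₀ hq1 (Nat.lt_succ_self n)) (Nat.succ_pos _))
      (pow_le_pow_right₀ (Nat.one_le_of_lt hq3) (Nat.sub_le n 1)) (pow_pos hq3 _) (Nat.zero_le _)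

end InertPlace

end Summit.HodgeConjecture.HodgeConjecture.R90.S6

end
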